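import Summits.BirchSwinnertonDyer.BirchSwinnertonDyer.Theorems.KimAtThreeFineKatoKPortResidueField
import Mathlib.FieldTheory.Galois.Basic
import Mathlib.Topology.Algebra.Module.FiniteDimension
import Mathlib.Data.ZMod.QuotientGroup
import HarnessLib

/-!
# K-PORT glue (toward `hres`, step r3): the INERTIA GROUP of an UNRAMIFIED finite extension
# `K ⊇ ℚ_p` is trivial — a `ℚ_p`-automorphism of `K` moving `𝒪_K` within residue classes is `1`
# (cell `bsd-addord`, seat w2-kport gen 2; `--supports stmt-BirchSwinnertonDyer-19560`, helper)

HONEST FRAMING. Route W2 (`route-BirchSwinnertonDyer-KimAtThreeKolyvagin`), crux 19560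
`KatoKuriharaPortThreeShared`, residual ⟨C1⟩ clause (C1.c), hypothesis `hres` of gen 0's
`KPort.consumer_of_exists_norm_not_mem_kernel`. The residue-field proof of `hres` (inventory
HOME/kport/KPORT-INVENTORY-g0.md §6) needs (r3): `Gal(K/ℚ_p) → Gal(k/𝔽_p)` is injective for `K`
unramified, i.e. the inertia group is trivial. In the port's currency `K` is an abstract complete
ultrametric `ℚ_p`-algebra, finite-dimensional, with the unramifiedness hypothesis of the SAT₀ files
`hK : ∀ x, ‖x‖ < 1 → ‖x‖ ≤ ‖p‖` (`𝔪_K = p𝒪_K`). This file proves, from `hK` ALONE (no appeal to the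
fundamental identity `[K : ℚ_p] = e·f`, which the tree does not have for an abstract `K`):

  `algEquiv_eq_one_of_forall_norm_sub_lt_one`: if `σ ∈ Aut_{ℚ_p}(K)` satisfies `‖σx − x‖ < 1` for all
  `x ∈ 𝒪_K`, then `σ = 1`;

and its corollary `algEquiv_eq_of_forall_norm_sub_lt_one` (`σ̄ = τ̄ ⇒ σ = τ`). PROOF (Serre, *Local
Fields*, I §7 Prop. 21/22 and IV §1, rearranged to avoid `e·f = n`): replace `σ` by a power of prime
order `ℓ`, let `L = Fix⟨σ⟩`. (f = 1) every `u ∈ 𝒪_K` is congruent mod `𝔪_K` to some `l ∈ 𝒪_L`: for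
`ℓ ≠ p` take `l = ℓ⁻¹ ∑ᵢ σⁱu`; for `ℓ = p` take `l = ∏ᵢ σⁱw` with `w̄ᵖ = ū` (Frobenius is onto the FINITE
residue field, `…KPortResidueField`). (e = 1, i.e. `hK`) then `u − l ∈ p𝒪_K`, and iterating,
`u ∈ ∑ pⁱ 𝒪_L + pⁿ𝒪_K` for all `n`, so `𝒪_K ⊆ closure(L) = L` (a finite-dimensional `ℚ_p`-subspace is
closed), `L = K`, contradicting `[K : L] = ℓ` (Mathlib `IntermediateField.finrank_fixedField_eq_card`).
TOOL theorems only (no definition, no named fact, no `sorry`); closes nothing by itself; nothing booked.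

## What is proved (`G = K ≃ₐ[ℚ_[p]] K`, "`τ` inertial" = `∀ x, ‖x‖ ≤ 1 → ‖τx − x‖ < 1`)

* §1 `norm_sum_lt_of_forall_lt` (strict ultrametric bound for finite sums), `norm_natCast_eq_one_of_prime_ne`;
  fixed field of `⟨τ⟩`: `mem_fixedField_zpowers_iff`, `sum_zpowers_apply_mem_fixedField`,
  `prod_zpowers_apply_mem_fixedField`.
* §2 (f = 1) `exists_mem_fixedField_norm_sub_lt_one` for `τ` inertial of prime order.
* §3 (approximation) `exists_mem_fixedField_norm_sub_le_pow`, `mem_fixedField_of_norm_le_one`,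
  `fixedField_zpowers_eq_top`, `not_prime_orderOf_of_inertial`.
* §4 **`algEquiv_eq_one_of_forall_norm_sub_lt_one`**, **`algEquiv_eq_of_forall_norm_sub_lt_one`**.

References: J.-P. Serre, *Local Fields* (1979), Ch. I §7 Prop. 21–22, Ch. III §5, Ch. IV §1
[SerreLocalFields1979]; J. W. S. Cassels, *Local Fields* (1986), Ch. 7 [Cassels1986].
-/

noncomputable section

-- the cell's Theorems namespace `Summit.BirchSwinnertonDyer.BirchSwinnertonDyer.…` repeats the summit name by design (D-0017)
set_option linter.dupNamespace false

open scoped Classical NNReal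

namespace Summit.BirchSwinnertonDyer.BirchSwinnertonDyer.Theorems.KPort

open Summit.BirchSwinnertonDyer.Rank1Residual.Additive.BallEval
open Literature.NumberTheory.GaloisRepresentations.LubinTate (unitBall mem_unitBall_iff)
open IntermediateField (fixedField)

variable {p : ℕ} [hp : Fact p.Prime] {K : Type*} [NontriviallyNormedField K] [NormedAlgebra ℚ_[p] K]
  [IsUltrametricDist K]

/-! ## §1 Small tools: strict ultrametric sums, `‖ℓ‖ = 1`, the fixed field of a cyclic group -/

section Tools

omit [NormedAlgebra ℚ_[p] K] hp in
/-- Strict ultrametric bound for a finite sum: all terms `< C` (`C > 0`) ⇒ the sum is `< C`. [folklore] -/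
theorem norm_sum_lt_of_forall_lt {ι : Type*} {s : Finset ι} {f : ι → K} {C : ℝ} (hC : 0 < C)
    (h : ∀ i ∈ s, ‖f i‖ < C) : ‖∑ i ∈ s, f i‖ < C := by
  induction s using Finset.induction_on with
  | empty => rw [Finset.sum_empty, norm_zero]; exact hC
  | insert a s ha ih =>
    rw [Finset.sum_insert ha]
    refine lt_of_le_of_lt (IsUltrametricDist.norm_add_le_max _ _) (max_lt ?_ ?_)
    · exact h a (Finset.mem_insert_self a s)
    · exact ih fun i hi => h i (Finset.mem_insert_of_mem hi)

omit [IsUltrametricDist K] in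
/-- `‖ℓ‖ = 1` in `K` for a prime `ℓ ≠ p`. [folklore] -/
theorem norm_natCast_eq_one_of_prime_ne {ℓ : ℕ} (hℓ : ℓ.Prime) (hne : ℓ ≠ p) : ‖(ℓ : K)‖ = 1 := by
  rw [← map_natCast (algebraMap ℚ_[p] K) ℓ, norm_algebraMap', Padic.norm_natCast_eq_one_iff]
  exact (Nat.coprime_primes hp.out hℓ).mpr (Ne.symm hne)

variable [FiniteDimensional ℚ_[p] K]

omit [IsUltrametricDist K] in
/-- `x ∈ Fix⟨τ⟩ ↔ τ x = x`. [folklore] -/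
theorem mem_fixedField_zpowers_iff (τ : K ≃ₐ[ℚ_[p]] K) (x : K) :
    x ∈ fixedField (Subgroup.zpowers τ) ↔ τ x = x := by
  rw [IntermediateField.mem_fixedField_iff]
  refine ⟨fun h => h τ (Subgroup.mem_zpowers τ), fun h φ hφ => ?_⟩
  rw [← (isOfFinOrder_of_finite τ).mem_powers_iff_mem_zpowers] at hφ
  obtain ⟨n, rfl⟩ := hφ
  dsimp only
  induction n with
  | zero => rfl
  | succ n ih => rw [pow_succ, AlgEquiv.mul_apply, h, ih]

omit [IsUltrametricDist K] in
/-- `∑_{φ ∈ ⟨τ⟩} φ(u) ∈ Fix⟨τ⟩` (reindex by `φ ↦ τφ`). [folklore] -/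
theorem sum_zpowers_apply_mem_fixedField (τ : K ≃ₐ[ℚ_[p]] K) (u : K) :
    (∑ φ : Subgroup.zpowers τ, (φ : K ≃ₐ[ℚ_[p]] K) u) ∈ fixedField (Subgroup.zpowers τ) := by
  rw [mem_fixedField_zpowers_iff, map_sum]
  exact Fintype.sum_equiv (Equiv.mulLeft ⟨τ, Subgroup.mem_zpowers τ⟩) _ _ fun φ => rfl

omit [IsUltrametricDist K] in
/-- `∏_{φ ∈ ⟨τ⟩} φ(u) ∈ Fix⟨τ⟩`. [folklore] -/
theorem prod_zpowers_apply_mem_fixedField (τ : K ≃ₐ[ℚ_[p]] K) (u : K) :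
    (∏ φ : Subgroup.zpowers τ, (φ : K ≃ₐ[ℚ_[p]] K) u) ∈ fixedField (Subgroup.zpowers τ) := by
  rw [mem_fixedField_zpowers_iff, map_prod]
  exact Fintype.prod_equiv (Equiv.mulLeft ⟨τ, Subgroup.mem_zpowers τ⟩) _ _ fun φ => rfl

omit [IsUltrametricDist K] in
/-- `|⟨τ⟩| = ord τ` as a `Finset.univ` cardinality. [folklore] -/
theorem card_univ_zpowers (τ : K ≃ₐ[ℚ_[p]] K) :
    (Finset.univ : Finset (Subgroup.zpowers τ)).card = orderOf τ := by
  rw [Finset.card_univ, ← Nat.card_eq_fintype_card, Nat.card_zpowers]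

end Tools

/-! ## §2 (f = 1) Residue descent to the fixed field of an inertial `τ` of prime order -/

section ResidueDescent

variable [FiniteDimensional ℚ_[p] K]

/-- **Residue descent.** Let `τ ∈ Aut_{ℚ_p}(K)` be inertial (`‖τx − x‖ < 1` on `𝒪_K`) of prime order
`ℓ`, `L = Fix⟨τ⟩`. Then every `u ∈ 𝒪_K` is congruent mod `𝔪_K` to some `l ∈ 𝒪_L`: `k_K = k_L`
(for `ℓ ≠ p`: `l = ℓ⁻¹ ∑ᵢ τⁱu`; for `ℓ = p`: `l = ∏ᵢ τⁱ w` with `w̄ ^ p = ū`).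
[cite: SerreLocalFields1979, Ch. I §7 Prop. 21–22 and Ch. IV §1] -/
theorem exists_mem_fixedField_norm_sub_lt_one {τ : K ≃ₐ[ℚ_[p]] K}
    (hτ : ∀ x : K, ‖x‖ ≤ 1 → ‖τ x - x‖ < 1) (hℓ : (orderOf τ).Prime) {u : K} (hu : ‖u‖ ≤ 1) :
    ∃ l ∈ fixedField (Subgroup.zpowers τ), ‖l‖ ≤ 1 ∧ ‖u - l‖ < 1 := by
  haveI : Algebra.IsAlgebraic ℚ_[p] K := Algebra.IsAlgebraic.of_finite ℚ_[p] K
  have hfin : IsOfFinOrder τ := isOfFinOrder_of_finite τ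
  have hφ : ∀ φ : Subgroup.zpowers τ, ∀ x : K, ‖x‖ ≤ 1 → ‖(φ : K ≃ₐ[ℚ_[p]] K) x - x‖ < 1 :=
    fun φ x hx => norm_galois_sub_lt_one_of_mem_zpowers hfin hτ φ.2 x hx
  by_cases hℓp : orderOf τ = p
  · -- `ℓ = p`: norm of a `p`-th root mod `𝔪`
    obtain ⟨w, hw, hwu⟩ := exists_norm_pow_prime_sub_lt_one p K hu
    let a : Subgroup.zpowers τ → unitBall K := fun φ =>
      ⟨(φ : K ≃ₐ[ℚ_[p]] K) w, (mem_unitBall_iff K).mpr (norm_galois_le_one _ hw)⟩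
    have hres : ∀ φ, IsLocalRing.residue (unitBall K) (a φ) =
        IsLocalRing.residue (unitBall K) ⟨w, (mem_unitBall_iff K).mpr hw⟩ := fun φ => by
      rw [residue_eq_residue_iff_norm_sub_lt_one]; exact hφ φ w hw
    have hprod : IsLocalRing.residue (unitBall K) (∏ φ, a φ) =
        IsLocalRing.residue (unitBall K) (⟨w, (mem_unitBall_iff K).mpr hw⟩ ^ p) := by
      rw [map_prod, map_pow, Finset.prod_congr rfl fun φ _ => hres φ, Finset.prod_const, card_univ_zpowers, hℓp]
    rw [residue_eq_residue_iff_norm_sub_lt_one] at hprod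
    have hcoe : (((∏ φ, a φ : unitBall K)) : K) = ∏ φ : Subgroup.zpowers τ, (φ : K ≃ₐ[ℚ_[p]] K) w := by
      push_cast; rfl
    refine ⟨∏ φ : Subgroup.zpowers τ, (φ : K ≃ₐ[ℚ_[p]] K) w, prod_zpowers_apply_mem_fixedField τ w, ?_, ?_⟩
    · rw [← hcoe]; exact (mem_unitBall_iff K).mp (∏ φ, a φ).2
    · have e : u - ∏ φ : Subgroup.zpowers τ, (φ : K ≃ₐ[ℚ_[p]] K) w =
          -((((∏ φ, a φ : unitBall K)) : K) - w ^ p) + -(w ^ p - u) := by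
        rw [hcoe]; ring
      rw [e]
      refine lt_of_le_of_lt (IsUltrametricDist.norm_add_le_max _ _) (max_lt ?_ ?_)
      · rw [norm_neg]; exact hprod
      · rw [norm_neg]; exact hwu
  · -- `ℓ ≠ p`: trace divided by `ℓ`
    set S : K := ∑ φ : Subgroup.zpowers τ, (φ : K ≃ₐ[ℚ_[p]] K) u with hS
    have hℓ1 : ‖((orderOf τ : ℕ) : K)‖ = 1 := norm_natCast_eq_one_of_prime_ne hℓ hℓp
    have hℓ0 : ((orderOf τ : ℕ) : K) ≠ 0 := norm_pos_iff.mp (by rw [hℓ1]; exact one_pos)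
    have hdiff : ‖S - (orderOf τ : ℕ) * u‖ < 1 := by
      have e : S - (orderOf τ : ℕ) * u = ∑ φ : Subgroup.zpowers τ, ((φ : K ≃ₐ[ℚ_[p]] K) u - u) := by
        rw [Finset.sum_sub_distrib, Finset.sum_const, card_univ_zpowers, nsmul_eq_mul]
      rw [e]
      exact norm_sum_lt_of_forall_lt one_pos fun φ _ => hφ φ u hu
    refine ⟨((orderOf τ : ℕ) : K)⁻¹ * S, ?_, ?_, ?_⟩
    · exact mul_mem (inv_mem (natCast_mem _ _)) (sum_zpowers_apply_mem_fixedField τ u)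
    · have e : ((orderOf τ : ℕ) : K)⁻¹ * S = ((orderOf τ : ℕ) : K)⁻¹ * (S - (orderOf τ : ℕ) * u) + u := by
        field_simp; ring
      rw [e]
      refine le_trans (IsUltrametricDist.norm_add_le_max _ _) (max_le ?_ hu)
      rw [norm_mul, norm_inv, hℓ1, inv_one, one_mul]; exact hdiff.le
    · have e : u - ((orderOf τ : ℕ) : K)⁻¹ * S = -(((orderOf τ : ℕ) : K)⁻¹ * (S - (orderOf τ : ℕ) * u)) := by
        field_simp; ring
      rw [e, norm_neg, norm_mul, norm_inv, hℓ1, inv_one, one_mul]; exact hdiff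

end ResidueDescent

/-! ## §3 (e = 1) `p`-adic approximation: `𝒪_K ⊆ Fix⟨τ⟩`, hence no inertial `τ` of prime order -/

section Approximation

variable [FiniteDimensional ℚ_[p] K]

/-- Iterating residue descent along `𝔪_K = p𝒪_K`: every `u ∈ 𝒪_K` is within `‖p‖ⁿ` of `Fix⟨τ⟩`.
[cite: SerreLocalFields1979, Ch. I §7 Prop. 21–22 and Ch. IV §1] -/
theorem exists_mem_fixedField_norm_sub_le_pow (hK : ∀ x : K, ‖x‖ < 1 → ‖x‖ ≤ ‖(p : K)‖)
    {τ : K ≃ₐ[ℚ_[p]] K} (hτ : ∀ x : K, ‖x‖ ≤ 1 → ‖τ x - x‖ < 1) (hℓ : (orderOf τ).Prime)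
    (n : ℕ) {u : K} (hu : ‖u‖ ≤ 1) :
    ∃ l ∈ fixedField (Subgroup.zpowers τ), ‖u - l‖ ≤ ‖(p : K)‖ ^ n := by
  induction n generalizing u with
  | zero => exact ⟨0, zero_mem _, by rw [sub_zero, pow_zero]; exact hu⟩
  | succ n ih =>
    obtain ⟨l₀, hl₀, -, hul₀⟩ := exists_mem_fixedField_norm_sub_lt_one hτ hℓ hu
    obtain ⟨x, hx, hpx⟩ := exists_eq_prime_mul_of_norm_lt_one (p := p) hK hul₀
    obtain ⟨l₁, hl₁, hxl₁⟩ := ih hx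
    refine ⟨l₀ + p * l₁, add_mem hl₀ (mul_mem (natCast_mem _ _) hl₁), ?_⟩
    have e : u - (l₀ + p * l₁) = p * (x - l₁) := by rw [mul_sub, ← hpx]; ring
    rw [e, norm_mul, pow_succ']
    exact mul_le_mul_of_nonneg_left hxl₁ (norm_nonneg _)

/-- **`𝒪_K ⊆ Fix⟨τ⟩`** for an inertial `τ` of prime order in an unramified `K` (`Fix⟨τ⟩` is a
finite-dimensional `ℚ_p`-subspace, hence closed). [cite: SerreLocalFields1979, Ch. I §7 Prop. 21–22 and Ch. IV §1] -/
theorem mem_fixedField_of_norm_le_one (hK : ∀ x : K, ‖x‖ < 1 → ‖x‖ ≤ ‖(p : K)‖)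
    {τ : K ≃ₐ[ℚ_[p]] K} (hτ : ∀ x : K, ‖x‖ ≤ 1 → ‖τ x - x‖ < 1) (hℓ : (orderOf τ).Prime)
    {u : K} (hu : ‖u‖ ≤ 1) : u ∈ fixedField (Subgroup.zpowers τ) := by
  set L := fixedField (Subgroup.zpowers τ) with hL
  have hclosed : IsClosed ((L.toSubalgebra.toSubmodule : Submodule ℚ_[p] K) : Set K) :=
    Submodule.closed_of_finiteDimensional _
  have hmem : u ∈ closure ((L.toSubalgebra.toSubmodule : Submodule ℚ_[p] K) : Set K) := by
    rw [Metric.mem_closure_iff]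
    intro ε hε
    obtain ⟨n, hn⟩ := exists_norm_prime_pow_lt (p := p) (K := K) hε
    obtain ⟨l, hl, hul⟩ := exists_mem_fixedField_norm_sub_le_pow hK hτ hℓ n hu
    exact ⟨l, hl, by rw [dist_eq_norm]; exact lt_of_le_of_lt hul hn⟩
  rw [hclosed.closure_eq] at hmem
  exact hmem

/-- … hence `Fix⟨τ⟩ = K` (`K = ℚ_p · 𝒪_K`). [cite: SerreLocalFields1979, Ch. I §7 Prop. 21–22 and Ch. IV §1] -/
theorem fixedField_zpowers_eq_top (hK : ∀ x : K, ‖x‖ < 1 → ‖x‖ ≤ ‖(p : K)‖)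
    {τ : K ≃ₐ[ℚ_[p]] K} (hτ : ∀ x : K, ‖x‖ ≤ 1 → ‖τ x - x‖ < 1) (hℓ : (orderOf τ).Prime) :
    fixedField (Subgroup.zpowers τ) = ⊤ := by
  refine eq_top_iff.mpr fun x _ => ?_
  have hp0 : (p : K) ≠ 0 := norm_pos_iff.mp (norm_p_pos_lt (p := p) (K := K)).1
  by_cases hx : x = 0
  · rw [hx]; exact zero_mem _
  obtain ⟨n, hn⟩ := exists_norm_prime_pow_lt (p := p) (K := K) (inv_pos.mpr (norm_pos_iff.mpr hx))
  have hxn : ‖(p : K) ^ n * x‖ ≤ 1 := by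
    rw [norm_mul, norm_pow, ← le_div_iff₀ (norm_pos_iff.mpr hx), one_div]
    exact hn.le
  have hmem := mem_fixedField_of_norm_le_one hK hτ hℓ hxn
  have e : x = ((p : K) ^ n)⁻¹ * ((p : K) ^ n * x) := by field_simp
  rw [e]
  exact mul_mem (inv_mem (pow_mem (natCast_mem _ _) n)) hmem

/-- **No inertial automorphism of prime order** in an unramified `K/ℚ_p`
(`[K : Fix⟨τ⟩] = ord τ`, Mathlib `finrank_fixedField_eq_card`). [cite: SerreLocalFields1979, Ch. I §7 Prop. 21–22 and Ch. IV §1] -/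
theorem not_prime_orderOf_of_inertial (hK : ∀ x : K, ‖x‖ < 1 → ‖x‖ ≤ ‖(p : K)‖)
    {τ : K ≃ₐ[ℚ_[p]] K} (hτ : ∀ x : K, ‖x‖ ≤ 1 → ‖τ x - x‖ < 1) : ¬ (orderOf τ).Prime := by
  intro hℓ
  have h1 : Module.finrank (fixedField (Subgroup.zpowers τ)) K = 1 :=
    IntermediateField.finrank_eq_one_iff_eq_top.mpr (fixedField_zpowers_eq_top hK hτ hℓ)
  rw [IntermediateField.finrank_fixedField_eq_card, Nat.card_zpowers] at h1
  exact hℓ.one_lt.ne' h1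

end Approximation

/-! ## §4 The inertia group of an unramified `K/ℚ_p` is trivial -/

section Main

variable [FiniteDimensional ℚ_[p] K]

/-- **Trivial inertia for unramified `K ⊇ ℚ_p`.** Let `K` be a finite-dimensional complete
ultrametric `ℚ_p`-algebra (a field) with `𝔪_K = p𝒪_K` (`hK`). If `σ ∈ Aut_{ℚ_p}(K)` satisfies
`‖σx − x‖ < 1` for every `x ∈ 𝒪_K` (i.e. `σ` acts trivially on the residue field), then `σ = 1`.
[cite: SerreLocalFields1979, Ch. I §7 Prop. 21–22 and Ch. IV §1] -/
theorem algEquiv_eq_one_of_forall_norm_sub_lt_one (hK : ∀ x : K, ‖x‖ < 1 → ‖x‖ ≤ ‖(p : K)‖)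
    (σ : K ≃ₐ[ℚ_[p]] K) (hσ : ∀ x : K, ‖x‖ ≤ 1 → ‖σ x - x‖ < 1) : σ = 1 := by
  haveI : Algebra.IsAlgebraic ℚ_[p] K := Algebra.IsAlgebraic.of_finite ℚ_[p] K
  by_contra hne
  have hd0 : orderOf σ ≠ 0 := (orderOf_pos_iff.mpr (isOfFinOrder_of_finite σ)).ne'
  have hd1 : orderOf σ ≠ 1 := fun h => hne (orderOf_eq_one_iff.mp h)
  obtain ⟨ℓ, hℓ, hℓd⟩ := Nat.exists_prime_and_dvd hd1
  have hord : orderOf (σ ^ (orderOf σ / ℓ)) = ℓ := orderOf_pow_orderOf_div hd0 hℓd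
  refine not_prime_orderOf_of_inertial hK (τ := σ ^ (orderOf σ / ℓ)) ?_ (by rw [hord]; exact hℓ)
  exact norm_pow_galois_sub_lt_one hσ _

/-- **`σ̄ = τ̄ ⇒ σ = τ`**: two `ℚ_p`-automorphisms of an unramified `K` that agree modulo `𝔪_K` on `𝒪_K`
are equal. [cite: SerreLocalFields1979, Ch. I §7 Prop. 21–22 and Ch. IV §1] -/
theorem algEquiv_eq_of_forall_norm_sub_lt_one (hK : ∀ x : K, ‖x‖ < 1 → ‖x‖ ≤ ‖(p : K)‖)
    (σ τ : K ≃ₐ[ℚ_[p]] K) (h : ∀ x : K, ‖x‖ ≤ 1 → ‖σ x - τ x‖ < 1) : σ = τ := by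
  haveI : Algebra.IsAlgebraic ℚ_[p] K := Algebra.IsAlgebraic.of_finite ℚ_[p] K
  have h1 : τ⁻¹ * σ = 1 := algEquiv_eq_one_of_forall_norm_sub_lt_one hK (τ⁻¹ * σ) fun x hx =>
    (norm_inv_mul_galois_sub_lt_one_iff σ τ x).mpr (h x hx)
  have := congrArg (τ * ·) h1
  simpa [← mul_assoc] using this

end Main

end Summit.BirchSwinnertonDyer.BirchSwinnertonDyer.Theorems.KPort

end
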